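import Literature.Geometry.Riemannian.ShrinkerPotentialGrowthProofs
import HarnessLib

/-!
# The potential of a complete gradient shrinker is proper (Haslhofer–Müller 2011, Lemma 2.1)

For a complete (closed metric balls compact) connected gradient shrinking Ricci soliton
`Ric + Hess f = ½ g` of any dimension, with smooth potential normalised by `R + |∇f|² = f` and
with `R ≥ 0`, every sub-level set `{f ≤ c}` is compact:

* **`Shrinker.isCompact_potential_le`** — `IsCompact {y | f y ≤ c}` for every `c : ℝ`.

Proof (R. Haslhofer, R. Müller, Lemma 2.1): `|∇f|² ≤ f`, so `f` has a minimum point `p`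
(`HaslhoferMuller.exists_forall_potential_le`) and grows at least quadratically,
`¼ (d(p, x) − 5n)₊² ≤ f(x)` (`HaslhoferMuller.potential_lower_of_scalarCurvature_nonneg`, both in
`ShrinkerPotentialGrowthProofs.lean`); hence `{f ≤ c}` is a closed subset of the compact closed
ball of radius `5n + 2√(c₊) + 1` about `p`. The regularity instances of the smooth Levi-Civita
connection come from `isLocallyContMDiff_leviCivita_holds`. This is the dimension-free form of
`ThreeShrinker.isCompact_potential_le` (`ThreeShrinkerSectionalNonneg.lean`, stated for `𝓡 3`),
stated for manifolds modelled on any finite-dimensional real normed space `E` (so in particular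
for `𝓡 n = 𝓘(ℝ, EuclideanSpace ℝ (Fin n))`). The hypothesis `R ≥ 0` is Haslhofer–Müller's (2.6)
(Zhang 2009; in the tree `shrinkerScalarCurvature_nonneg_holds` for `𝓡 n`), kept as a hypothesis
here. Everything is proved; no definition and no named fact is introduced.

## References

* [HaslhoferMuller2011] R. Haslhofer, R. Müller, *A compactness theorem for complete Ricci
  shrinkers*, GAFA 21 (2011) 1091–1116 = arXiv:1005.3255, Lemma 2.1 (p. 5).
-/

noncomputable section

open Set Filter Module
open scoped Manifold ContDiff Topology NNReal ENNReal

namespace Literature.Geometry.Riemannian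

open Lorentzian Lorentzian.PseudoRiemannianMetric

namespace Shrinker

variable {E : Type*} [NormedAddCommGroup E] [NormedSpace ℝ E] [FiniteDimensional ℝ E]
  {M : Type*} [TopologicalSpace M] [ChartedSpace E M] [IsManifold 𝓘(ℝ, E) ∞ M]
  [T2Space M] [ConnectedSpace M]
  (g : PseudoRiemannianMetric 𝓘(ℝ, E) ∞ E (TangentSpace 𝓘(ℝ, E) : M → Type _)) [g.HasLeviCivita]

/-- **The potential of a complete shrinker is proper** (Haslhofer–Müller 2011, Lemma 2.1), any
dimension: on a connected gradient shrinker `Ric + Hess f = ½ g` with compact closed metric balls,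
smooth potential normalised by `R + |∇f|² = f`, and `R ≥ 0`, every sub-level set `{f ≤ c}` is
compact — it is closed and lies inside the closed ball of radius `5 dim M + 2√(c₊) + 1` about a
minimum point `p` of `f`, by the growth `¼ (d(p, ·) − 5 dim M)₊² ≤ f`.
[cite: HaslhoferMuller2011, Lemma 2.1 (p. 5)] -/
theorem isCompact_potential_le (hg : g.IsRiemannian)
    (hcpl : ∀ (x : M) (r : ℝ≥0), IsCompact {y : M | g.edist hg x y ≤ r})
    {f : M → ℝ} (hf : ContMDiff 𝓘(ℝ, E) 𝓘(ℝ, ℝ) ∞ f)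
    (hsol : ∀ (x : M) (X Y : TangentSpace 𝓘(ℝ, E) x),
      g.ricci x X Y + g.hessian f x X Y = (1 / 2 : ℝ) * g.val x X Y)
    (hnorm : ∀ x : M, g.scalarCurvature x + g.gradSq f x = f x)
    (hR0 : ∀ x : M, 0 ≤ g.scalarCurvature x) (c : ℝ) : IsCompact {y : M | f y ≤ c} := by
  -- adapted from `ThreeShrinker.isCompact_potential_le` (`ThreeShrinkerSectionalNonneg.lean`)
  haveI : CompleteSpace E := FiniteDimensional.complete ℝ E
  have hk1 : ((1 : ℕ∞) : ℕ∞ω) + 1 ≤ (∞ : ℕ∞ω) := by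
    rw [show ((1 : ℕ∞) : ℕ∞ω) + 1 = 2 by norm_num]
    exact WithTop.coe_le_coe.2 le_top
  haveI : CovariantDerivative.ContMDiffCovariantDerivative g.leviCivita 1 :=
    ⟨g.isLocallyContMDiff_leviCivita_holds 1 hk1 univ isOpen_univ⟩
  haveI : CovariantDerivative.ContMDiffCovariantDerivative g.leviCivita ∞ :=
    ⟨g.isLocallyContMDiff_leviCivita_holds ⊤ (le_of_eq rfl) univ isOpen_univ⟩
  have hgrad : ∀ x, g.gradSq f x ≤ f x := fun x ↦ by linarith [hR0 x, hnorm x]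
  obtain ⟨p, hp⟩ := HaslhoferMuller.exists_forall_potential_le g hg hcpl hf hgrad hsol
  set n : ℝ := (Module.finrank ℝ E : ℝ) with hn
  have hlow : ∀ (x : M) (r : ℝ≥0), (r : ℝ≥0∞) ≤ g.edist hg p x →
      (1 / 4 : ℝ) * (max ((r : ℝ) - 5 * n) 0) ^ 2 ≤ f x := fun x r hr ↦
    HaslhoferMuller.potential_lower_of_scalarCurvature_nonneg g hg hcpl hf hsol hnorm hR0 hp x r hr
  -- closed and inside a compact ball
  have hn0 : 0 ≤ n := Nat.cast_nonneg _
  have hv : 0 ≤ 5 * n + 2 * Real.sqrt (max c 0) + 1 := by positivity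
  set r₀ : ℝ≥0 := (5 * n + 2 * Real.sqrt (max c 0) + 1).toNNReal with hr₀
  refine (hcpl p r₀).of_isClosed_subset (isClosed_le hf.continuous continuous_const) fun x hx ↦ ?_
  rw [mem_setOf_eq] at hx ⊢
  by_contra hlt
  have hle : (r₀ : ℝ≥0∞) ≤ g.edist hg p x := le_of_lt (not_le.1 hlt)
  have h1 := hlow x r₀ hle
  have hr : (r₀ : ℝ) - 5 * n = 2 * Real.sqrt (max c 0) + 1 := by
    rw [hr₀, Real.coe_toNNReal _ hv]; ring
  rw [hr, max_eq_left (by positivity)] at h1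
  have hs : Real.sqrt (max c 0) ^ 2 = max c 0 := Real.sq_sqrt (le_max_right c 0)
  have hc' : c ≤ max c 0 := le_max_left _ _
  nlinarith [Real.sqrt_nonneg (max c 0)]

end Shrinker

end Literature.Geometry.Riemannian

end
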